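import Summits.AtomisticToContinuum.FouriersLaw.Theorems.OddSectorIrreversibilityBoundedResponseConvergesStubSelfSimilarGluingAux1

/-!
# Stub `stub_selfSimilarGluing` (S23) — STATUS: open (crux-sized); two more position markers

Crux `stmt-AtomisticToContinuum-9141` (`OddSectorIrreversibility.BoundedResponseConverges`), line
`two-scale-gluing-log-rigidity`, registered stub `stub_selfSimilarGluing` (S23): under the crux's prefix and
`0 < D N` (`N ≥ 2`), `∃ ε antitone, Σ_k ε(2^k) < ∞, ∃ N₀, ∀ N ≥ N₀, R_{2N} ≤ 2R_N + N ε N ∧ R_{3N} ≤ 3R_N + N ε N`,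
`R_N = (N-1)/D_N`. Companion of `…StubSelfSimilarGluingAux1` ((S23) ⇐ `FeketeSeriesLaw.QuasiSubadditiveResistance`,
stmt-AtomisticToContinuum-14041). This file does NOT declare the stub either; it records two sequence-level facts
that fix where (S23) sits (pure real analysis, nothing here closes an item):

* `selfSimilarShape_of_boundedDefect` — ANY supplier of an `O(1)` defect at the two self-similar splits only
  (`R_{2N} ≤ 2R_N + C`, `R_{3N} ≤ 3R_N + C` from some `N₁` on; e.g. a series law restricted to equal blocks, or an
  affine upper law `R_N ≤ a + bN + o(1)` together with `R_N ≥ bN - a'`) gives the (S23) matrix verbatim, with the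
  slack `ε N = 4 C⁺/(N+1)` of Aux1 and `N₀ = max N₁ 1`.
* `exists_tendsto_not_selfSimilarShape` — the crux's CONCLUSION does not imply (S23), even with a two-sided
  `N`-uniform bound: the response-shaped sequence `D_N = 1/(1 + (-1)^{L}/(L+2))`, `L = ⌊log₂ N⌋`, satisfies
  `2/3 ≤ D_N ≤ 3/2`, `D_N → 1`, and violates the doubling half of (S23) for EVERY admissible slack: at `N = 2^L`,
  `L` odd, `(R_{2N} - 2R_N)/N ≥ 2/(L+3)`, which no antitone `ε` with `Σ_k ε(2^k) < ∞` dominates. So no item of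
  strength ≤ the crux (9141 itself, `PositiveOrInfiniteLimit` 9128, `ConductanceLowerBound` 11749,
  `BoundedResponse`) can supply (S23); only RATE statements can (14041 via Aux1; the witness violates 14041 too,
  its doubling defect being `≍ N/log N`). Together with `Disproof.lean`'s `skeleton_selfSimilar_not_sufficient`
  ((S23) ⇏ convergence without (U)) this places (S23) strictly sideways of the crux: a log-scale regularity
  statement, neither implied by nor implying `D_N → k`.

Informal record (not formalised; assessed by the stub worker of lead 9141-1, 2026-08-16): the fixed-`N`
Green–Kubo/corrector calculus now in tree (`Corrector.CorrectorTheory_proof`, `corrector_smooth`,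
`tap_energy_identity`: `(N-1) T² D_N = Z⁻¹⟨u_N, J_N⟩_{μ_T} = Z⁻¹ γ T Σ_{b ∈ {0, N-1}} ‖∂_{p_b} u_N‖²`) does NOT yield
the one-sided bound `R_{2N} ≤ 2R_N + o(N)` by a trial-corrector argument: an upper bound on `R_{2N}` is a LOWER
bound on `⟨J_{2N}, (-L_{2N})⁻¹ J_{2N}⟩`, which for the non-reversible `L = A + γS` needs a trial pair `(g, h)` with
`A g = -S h` (the `H_{-1}(S)` constraint of the non-symmetric Dirichlet principle); the glued candidate
`g = u_N ⊕ u_N` misses this by `γ S_{N-1} u_N^{left} + γ S_N u_N^{right}` at the junction, whose Dirichlet size is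
exactly half of each block's dissipation (`γT‖∂_{p_{N-1}} u_N‖² = ⟨u_N, J_N⟩/2 ≍ N` by the reflection symmetry of
the `N`-chain) — an EXTENSIVE defect, not a boundary layer: in the boundary-driven chain the corrector's
dissipation sits at the two bath sites, so removing the two inner baths of `N ⊕ N` destroys half of it. Repairing
the defect means transporting it through the deterministic bulk to the outer baths, i.e. an `N`-uniform bound on
`(-L_{2N})⁻¹` on junction-localised sources — the open problem itself (BonettoLebowitzReyBellet2000 §6.3).
-/

noncomputable section

namespace Summit.AtomisticToContinuum.FouriersLaw.Cruxes.BoundedResponseConverges.TwoScaleGluingLogRigidity.Stubs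

open Filter Topology

/-! ## (S23) from an `O(1)` defect at the two self-similar splits -/

/-- **(S23) from a bounded self-similar defect.** If from some `N₁` on `R_{2N} ≤ 2R_N + C` and
`R_{3N} ≤ 3R_N + C` (`R_N = (N-1)/D_N`), then the (S23) matrix holds with the slack `ε N = 4C⁺/(N+1)`
(antitone, summable along `2^k`) and `N₀ = max N₁ 1`. [folklore] -/
theorem selfSimilarShape_of_boundedDefect :
    ∀ (D : ℕ → ℝ) (C : ℝ) (N₁ : ℕ), (∀ N : ℕ, N₁ ≤ N →
      (((2 * N : ℕ) : ℝ) - 1) / D (2 * N) ≤ 2 * (((N : ℝ) - 1) / D N) + C ∧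
      (((3 * N : ℕ) : ℝ) - 1) / D (3 * N) ≤ 3 * (((N : ℝ) - 1) / D N) + C) →
    ∃ ε : ℕ → ℝ, Antitone ε ∧ Summable (fun k : ℕ => ε (2 ^ k)) ∧
      ∃ N₀ : ℕ, ∀ N : ℕ, N₀ ≤ N →
        (((2 * N : ℕ) : ℝ) - 1) / D (2 * N) ≤ 2 * (((N : ℝ) - 1) / D N) + (N : ℝ) * ε N ∧
        (((3 * N : ℕ) : ℝ) - 1) / D (3 * N) ≤ 3 * (((N : ℝ) - 1) / D N) + (N : ℝ) * ε N := by
  intro D C N₁ h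
  set c : ℝ := max C 0 with hc
  have hc0 : 0 ≤ c := le_max_right _ _
  have hCc : C ≤ c := le_max_left _ _
  refine ⟨fun N => 4 * c / ((N : ℝ) + 1), gluing_slack_antitone hc0, ?_, max N₁ 1, fun N hN => ?_⟩
  · have := gluing_slack_summable c
    simpa using this
  have hN1 : N₁ ≤ N := le_trans (le_max_left _ _) hN
  have hNr : (1 : ℝ) ≤ N := by exact_mod_cast le_trans (le_max_right _ _) hN
  have hslack : C ≤ (N : ℝ) * (4 * c / ((N : ℝ) + 1)) := by
    have hpos : (0 : ℝ) < (N : ℝ) + 1 := by positivity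
    rw [mul_div_assoc', le_div_iff₀ hpos]
    nlinarith [hCc, hc0, hNr]
  obtain ⟨h2, h3⟩ := h N hN1
  exact ⟨h2.trans (by linarith), h3.trans (by linarith)⟩

/-! ## The crux's conclusion does not imply (S23): a convergent, two-sided bounded witness

The witness is `D_N = (1 + (-1)^L/(L+2))⁻¹`, `L = Nat.log 2 N`; no auxiliary definitions are introduced
(the level `1 + (-1)^k/(k+2)` is written out), so that this file stays a pure proof file. -/

/-- The dyadic level `1 + (-1)^k/(k+2)` lies in `[2/3, 3/2]`. [folklore] -/
private lemma level_bounds (k : ℕ) :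
    2 / 3 ≤ 1 + (-1 : ℝ) ^ k / ((k : ℝ) + 2) ∧ 1 + (-1 : ℝ) ^ k / ((k : ℝ) + 2) ≤ 3 / 2 := by
  have hk0 : (0 : ℝ) ≤ k := Nat.cast_nonneg k
  have hk2 : (2 : ℝ) ≤ (k : ℝ) + 2 := by linarith
  rcases Nat.even_or_odd k with hk | hk
  · rw [hk.neg_one_pow]
    have h0 : 0 ≤ 1 / ((k : ℝ) + 2) := by positivity
    have h1 : 1 / ((k : ℝ) + 2) ≤ 1 / 2 := div_le_div_of_nonneg_left zero_le_one (by norm_num) hk2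
    constructor <;> linarith
  · rw [hk.neg_one_pow]
    have hk1 : 1 ≤ k := by obtain ⟨m, rfl⟩ := hk; omega
    have hk3 : (3 : ℝ) ≤ (k : ℝ) + 2 := by
      have : (1 : ℝ) ≤ k := by exact_mod_cast hk1
      linarith
    have h0 : 0 ≤ 1 / ((k : ℝ) + 2) := by positivity
    have h1 : 1 / ((k : ℝ) + 2) ≤ 1 / 3 := div_le_div_of_nonneg_left zero_le_one (by norm_num) hk3
    have h' : (-1 : ℝ) / ((k : ℝ) + 2) = -(1 / ((k : ℝ) + 2)) := by ring
    rw [h']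
    constructor <;> linarith

/-- Inversion keeps `[2/3, 3/2]`. [folklore] -/
private lemma inv_bounds {x : ℝ} (h : 2 / 3 ≤ x ∧ x ≤ 3 / 2) : 2 / 3 ≤ x⁻¹ ∧ x⁻¹ ≤ 3 / 2 := by
  obtain ⟨h1, h2⟩ := h
  have hpos : 0 < x := by linarith
  rw [inv_eq_one_div]
  constructor
  · rw [le_div_iff₀ hpos]; linarith
  · rw [div_le_iff₀ hpos]; linarith

/-- The dyadic level tends to `1`. [folklore] -/
private lemma level_tendsto : Tendsto (fun k : ℕ => 1 + (-1 : ℝ) ^ k / ((k : ℝ) + 2)) atTop (𝓝 1) := by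
  have hs : Tendsto (fun k : ℕ => (-1 : ℝ) ^ k / ((k : ℝ) + 2)) atTop (𝓝 0) := by
    refine squeeze_zero_norm (fun k => ?_) tendsto_one_div_add_atTop_nhds_zero_nat
    rw [norm_div, norm_pow, norm_neg, norm_one, one_pow, Real.norm_eq_abs,
      abs_of_pos (by positivity : (0 : ℝ) < (k : ℝ) + 2)]
    exact div_le_div_of_nonneg_left zero_le_one (by positivity) (by linarith)
  have := (tendsto_const_nhds (x := (1 : ℝ))).add hs
  simpa using this

/-- `Nat.log 2` tends to infinity. [folklore] -/
private lemma natLog_two_tendsto : Tendsto (Nat.log 2) atTop atTop :=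
  tendsto_atTop_atTop_of_monotone Nat.log_monotone
    (fun b => ⟨2 ^ b, (Nat.log_pow (by norm_num) b).ge⟩)

/-- **The crux's conclusion does not imply (S23).** There is a response-shaped sequence `D` with
`2/3 ≤ D_N ≤ 3/2` for all `N` (so `0 < D_N` and `|D_N|` is bounded) and `D_N → 1`, for which the (S23)
matrix FAILS for every antitone, dyadically summable slack `ε` and every threshold `N₀`:
`D_N = 1/(1 + (-1)^L/(L+2))`, `L = ⌊log₂ N⌋`; at `N = 2^L` with `L` odd the doubling defect is
`(R_{2N} - 2R_N)/N ≥ 2/(L+3)`, and `Σ_{L odd} 2/(L+3) = ∞`. Hence (S23) is a genuine log-scale regularity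
statement, not a corollary of `D_N → k > 0`: a log-periodic finite-size oscillation of infinite dyadic
variation would break it with Fourier's law intact. [folklore] -/
theorem exists_tendsto_not_selfSimilarShape :
    ∃ D : ℕ → ℝ, (∀ N : ℕ, 2 / 3 ≤ D N ∧ D N ≤ 3 / 2) ∧ BddAbove (Set.range fun N => |D N|) ∧
      Filter.Tendsto D Filter.atTop (nhds 1) ∧
      ¬ ∃ ε : ℕ → ℝ, Antitone ε ∧ Summable (fun k : ℕ => ε (2 ^ k)) ∧
        ∃ N₀ : ℕ, ∀ N : ℕ, N₀ ≤ N →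
          (((2 * N : ℕ) : ℝ) - 1) / D (2 * N) ≤ 2 * (((N : ℝ) - 1) / D N) + (N : ℝ) * ε N ∧
          (((3 * N : ℕ) : ℝ) - 1) / D (3 * N) ≤ 3 * (((N : ℝ) - 1) / D N) + (N : ℝ) * ε N := by
  refine ⟨fun N => (1 + (-1 : ℝ) ^ (Nat.log 2 N) / ((Nat.log 2 N : ℝ) + 2))⁻¹,
    fun N => inv_bounds (level_bounds (Nat.log 2 N)), ⟨3 / 2, ?_⟩, ?_, ?_⟩
  · rintro _ ⟨N, rfl⟩
    obtain ⟨h1, h2⟩ := inv_bounds (level_bounds (Nat.log 2 N))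
    dsimp only
    rw [abs_of_nonneg (by linarith)]
    exact h2
  · have := (level_tendsto.comp natLog_two_tendsto).inv₀ one_ne_zero
    simpa using this
  rintro ⟨ε, hεa, hεs, N₀, hS⟩
  -- Step 1: at `N = 2^k`, `k` odd, the doubling inequality forces `ε (2^k) ≥ 2/(k+3)`.
  have key : ∀ k : ℕ, Odd k → N₀ ≤ 2 ^ k → 2 / ((k : ℝ) + 3) ≤ ε (2 ^ k) := by
    intro k hk hkN
    obtain ⟨h2, -⟩ := hS (2 ^ k) hkN
    have h2' : (((2 * 2 ^ k : ℕ) : ℝ) - 1) /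
          (1 + (-1 : ℝ) ^ (Nat.log 2 (2 * 2 ^ k)) / ((Nat.log 2 (2 * 2 ^ k) : ℝ) + 2))⁻¹ ≤
        2 * ((((2 ^ k : ℕ) : ℝ) - 1) /
          (1 + (-1 : ℝ) ^ (Nat.log 2 (2 ^ k)) / ((Nat.log 2 (2 ^ k) : ℝ) + 2))⁻¹) +
        ((2 ^ k : ℕ) : ℝ) * ε (2 ^ k) := h2
    have hlog1 : Nat.log 2 (2 ^ k) = k := Nat.log_pow (by norm_num) k
    have hlog2 : Nat.log 2 (2 * 2 ^ k) = k + 1 := by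
      rw [← pow_succ', Nat.log_pow (by norm_num)]
    have hv1 : 1 + (-1 : ℝ) ^ (Nat.log 2 (2 ^ k)) / ((Nat.log 2 (2 ^ k) : ℝ) + 2) =
        1 - 1 / ((k : ℝ) + 2) := by
      rw [hlog1, hk.neg_one_pow]; ring
    have hv2 : 1 + (-1 : ℝ) ^ (Nat.log 2 (2 * 2 ^ k)) / ((Nat.log 2 (2 * 2 ^ k) : ℝ) + 2) =
        1 + 1 / ((k : ℝ) + 3) := by
      rw [hlog2, (hk.add_one).neg_one_pow]; push_cast; ring
    rw [hv2, hv1, div_inv_eq_mul, div_inv_eq_mul] at h2'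
    push_cast at h2'
    have hk1 : 1 ≤ k := by obtain ⟨m, rfl⟩ := hk; omega
    have hM : (2 : ℝ) ≤ (2 : ℝ) ^ k := by
      calc (2 : ℝ) = 2 ^ 1 := by norm_num
        _ ≤ 2 ^ k := pow_le_pow_right₀ (by norm_num) hk1
    rw [show (2 : ℝ) / ((k : ℝ) + 3) = 2 * (1 / ((k : ℝ) + 3)) by ring]
    set M : ℝ := (2 : ℝ) ^ k with hMdef
    set a : ℝ := 1 / ((k : ℝ) + 2) with hadef
    set b : ℝ := 1 / ((k : ℝ) + 3) with hbdef
    have hk0 : (0 : ℝ) ≤ k := Nat.cast_nonneg k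
    have ha : 0 ≤ a := by positivity
    have hb0 : 0 ≤ b := by positivity
    have hb1 : b ≤ 1 := by
      rw [hbdef, div_le_one (by positivity)]; linarith
    have hMpos : 0 < M := by positivity
    have hmain : M * (2 * b) ≤ M * ε (2 ^ k) := by
      nlinarith [h2', mul_nonneg ha (by linarith : (0 : ℝ) ≤ M - 1), hb1, hb0]
    exact le_of_mul_le_mul_left hmain hMpos
  -- Step 2: from the threshold `k₁` on, `ε (2^k) ≥ 1/(k+2)` for every `k` (even `k` via antitonicity).
  set k₁ : ℕ := Nat.log 2 N₀ + 1 with hk₁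
  have hpow : ∀ k, k₁ ≤ k → N₀ ≤ 2 ^ k := fun k hk =>
    (Nat.lt_pow_succ_log_self (by norm_num : 1 < 2) N₀).le.trans (Nat.pow_le_pow_right (by norm_num) hk)
  have lower : ∀ k, k₁ ≤ k → 1 / ((k : ℝ) + 2) ≤ ε (2 ^ k) := by
    intro k hk
    have hk0 : (0 : ℝ) ≤ k := Nat.cast_nonneg k
    rcases Nat.even_or_odd k with he | ho
    · have h1 := key (k + 1) he.add_one (hpow (k + 1) (by omega))
      have hanti : ε (2 ^ (k + 1)) ≤ ε (2 ^ k) :=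
        hεa (Nat.pow_le_pow_right (by norm_num) (Nat.le_succ k))
      push_cast at h1
      have : 1 / ((k : ℝ) + 2) ≤ 2 / ((k : ℝ) + 1 + 3) := by
        rw [div_le_div_iff₀ (by positivity) (by positivity)]; nlinarith
      linarith
    · have h1 := key k ho (hpow k hk)
      have : 1 / ((k : ℝ) + 2) ≤ 2 / ((k : ℝ) + 3) := by
        rw [div_le_div_iff₀ (by positivity) (by positivity)]; nlinarith
      linarith
  -- Step 3: comparison with the harmonic series.
  have hs1 : Summable (fun n : ℕ => ε (2 ^ (n + k₁))) :=
    (summable_nat_add_iff (f := fun k : ℕ => ε (2 ^ k)) k₁).2 hεs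
  have hs2 : Summable (fun n : ℕ => 1 / (((n + k₁ : ℕ) : ℝ) + 2)) := by
    refine Summable.of_nonneg_of_le (fun n => by positivity) (fun n => ?_) hs1
    exact lower (n + k₁) (by omega)
  have hs3 : Summable (fun n : ℕ => 1 / ((n : ℝ) + 2)) :=
    (summable_nat_add_iff (f := fun n : ℕ => 1 / ((n : ℝ) + 2)) k₁).1 hs2
  have hs4 : Summable (fun n : ℕ => 1 / (n : ℝ)) := by
    refine (summable_nat_add_iff (f := fun n : ℕ => 1 / (n : ℝ)) 2).1 ?_
    have heq : (fun n : ℕ => 1 / ((n + 2 : ℕ) : ℝ)) = fun n : ℕ => 1 / ((n : ℝ) + 2) := by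
      funext n; push_cast; ring
    show Summable (fun n : ℕ => 1 / ((n + 2 : ℕ) : ℝ))
    rw [heq]; exact hs3
  exact Real.not_summable_one_div_natCast hs4

end Summit.AtomisticToContinuum.FouriersLaw.Cruxes.BoundedResponseConverges.TwoScaleGluingLogRigidity.Stubs

end
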